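import Mathlib
import Summits.AtomisticToContinuum.Crystallization.Theorems.NashClassCertificatesNashNearFieldEnergySplitInterior
import Summits.AtomisticToContinuum.Crystallization.Theorems.PhononSlackCertificatesNearFieldConvexityStubInterfaceOfPairCount
import Summits.AtomisticToContinuum.Crystallization.Theorems.PhononSlackCertificatesNearFieldConvexityStubPairCountOfCrossing
import Summits.AtomisticToContinuum.Crystallization.Theorems.PhononSlackCertificatesNearFieldConvexityStubPnfOfLocalCertificate8
import Summits.AtomisticToContinuum.Crystallization.Theorems.PhononSlackCertificatesNearFieldConvexityStubChartSites
import Summits.AtomisticToContinuum.Crystallization.Theorems.PhononSlackCertificatesNearFieldConvexityStubChartCoverage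
import Summits.AtomisticToContinuum.Crystallization.Theorems.PhononSlackCertificatesNearFieldConvexityCoarseRegime
import Summits.AtomisticToContinuum.Crystallization.Theorems.NashClassCertificatesNashNearFieldStubNashForceBalance
import Summits.AtomisticToContinuum.Crystallization.Theorems.NashClassCertificatesNashNearFieldStubChartCoreAssemblyWeak
import Summits.AtomisticToContinuum.Crystallization.Theorems.NashClassCertificatesNashNearFieldStubOffFamilyOfNonLayered
import Summits.AtomisticToContinuum.Crystallization.Theorems.NashClassCertificatesNashNearFieldStubLabelledPlacement

/-!
# Route `NashClassCertificates`, crux `NashNearField` (stmt-AtomisticToContinuum-16827), line `birth` (skeleton v10):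
# the ENERGY-SPLIT COMPOSITION on the Nash class, part II — the crux BY NAME modulo the two registered energy stubs

`nashNearField_of_energySplit : I_flat(Nash) → II_band(Nash) → NashClassCertificates.NashNearField`, with I_flat(Nash) / II_band(Nash) the
exact registered texts of `stub_nashFlatnessPaid` / `stub_nashRoughSitesPaid` (skeleton v10 of `Cruxes/NashNearField/Lines/birth.lean`).
Chain (all proved): interior coercivity (`es_interiorCoercivity_of_split`, part I, with C′ = the landed `stub_offFamilyOfNonLayered` and
radius-3 charts from `chart_of_stubs_radius` on the landed chart core) ⟹ the PURE near field on the Nash class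
(`es_pnf_of_interiorCoercivity`: charts at radius-8 interior sites, exact force balance from the Nash clause by the landed
`stub_nashForceBalance`, the radius-8 collar `#(Ω ∖ int₈Ω) ≤ (1 + |C_pc|(17/4)⁴)·#∂₄Ω` by `collar8_card_le` + `stub_pairCountOfCrossing`) ⟹ the
crux (`es_nashNearField_of_pnf`: cross terms with `Ωᶜ` are boundary-summable, `pnf_cross_floor` + the interface lemma
`stub_interfaceOfPairCount stub_pairCountOfCrossing`).  All `[folklore]` bookkeeping; the mathematics is in the two stubs.
-/

noncomputable section

open scoped BigOperators
open Literature.MathematicalPhysics.StatisticalMechanics Literature.Geometry.DiscreteGeometry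

namespace Summit.AtomisticToContinuum.Crystallization.Theorems.NashClassCertificatesNashNearField

open Summit.AtomisticToContinuum.Crystallization.Theorems.PhononSlackNearFieldConvexity

/-- `1/3`-separated points are pairwise distinct. -/
theorem es_distinct_of_sep {N : ℕ} {x : Fin N → EuclideanSpace ℝ (Fin 3)}
    (hsep : ∀ i j : Fin N, i ≠ j → 1 / 3 ≤ dist (x i) (x j)) : ∀ i j : Fin N, i ≠ j → x i ≠ x j := by
  intro i j hij h
  have := hsep i j hij
  rw [h, dist_self] at this
  norm_num at this


/-- **Glue (proved): the stubs ⟹ NashPNF.**  At a radius-8 interior site of a good `Ω` the chart is supplied by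
`chart_of_stubs` on the landed coverage/sites pieces and `stub_chartCore`; force balance is supplied by
`stub_nashForceBalance` from the Nash clause (points are distinct by separation); the interior coercivity then
pays the INTERIOR non-layered count, and the remaining non-layered sites lie in the radius-8 collar
`B₈ = Ω ∖ int₈Ω`, whose size is `≤ (1 + |Cp|(17/4)⁴)·#∂₄Ω` by the landed collar count (`collar8_card_le`) and
pair count at scale `17/4` (`stub_pairCountOfCrossing`).  Constants: `c := c`, `C' := C + c·(1 + |Cp|(17/4)⁴)`. -/
theorem es_pnf_of_interiorCoercivity
    (hcore : ∀ (N : ℕ) (x : Fin N → EuclideanSpace ℝ (Fin 3)) (i : Fin N),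
      (∀ k : Fin N, dist (x k) (x i) ≤ 3 → IsTwoShellGood (1 / 20) (47 / 50) 1 x k) →
      ∀ (a : ℝ) (A : EuclideanSpace ℝ (Fin 3) →ₗᵢ[ℝ] EuclideanSpace ℝ (Fin 3)) (P : Finset (EuclideanSpace ℝ (Fin 3))) (f : EuclideanSpace ℝ (Fin 3) → Fin N),
        47 / 50 ≤ a → a ≤ 1 → (P = fccTwoShellPattern ∨ P = hcpTwoShellPattern) →
        (∀ v ∈ P, f v ≠ i ∧ dist (x (f v)) (x i + a • A v) ≤ 1 / 20 * a) → Set.InjOn f ↑P →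
        (∀ j : Fin N, j ≠ i → dist (x j) (x i) ≤ 3 / 2 * a → ∃ v ∈ P, f v = j) →
        ∃ (R : EuclideanSpace ℝ (Fin 3) →ₗᵢ[ℝ] EuclideanSpace ℝ (Fin 3)) (s : ℤ → ℤ), IsHaggSeq s ∧
          (∀ v ∈ P, ∃ m u w : ℤ, R (barlowPos 1 (Real.sqrt 6 / 3) s m u w) = v) ∧
          (∀ m u w : ℤ, ‖barlowPos 1 (Real.sqrt 6 / 3) s m u w‖ ≤ 3 / 2 → barlowPos 1 (Real.sqrt 6 / 3) s m u w ≠ 0 → R (barlowPos 1 (Real.sqrt 6 / 3) s m u w) ∈ P) ∧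
          (∀ v ∈ P, ∀ k : Fin N, dist (x k) (x (f v)) ≤ 141 / 100 → dist (x k) (x i) ≤ 2 →
            ∃ m u w : ℤ, dist (x k) (x i + a • A (R (barlowPos 1 (Real.sqrt 6 / 3) s m u w))) ≤ 2 / 5) ∧
          (∀ v ∈ P, ∀ m u w : ℤ, ‖barlowPos 1 (Real.sqrt 6 / 3) s m u w‖ ≤ 43 / 20 → dist (R (barlowPos 1 (Real.sqrt 6 / 3) s m u w)) v ≤ 3 / 2 →
            ∃ k : Fin N, dist (x k) (x i + a • A (R (barlowPos 1 (Real.sqrt 6 / 3) s m u w))) ≤ 2 / 5))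
    (hfb : ∀ (N : ℕ) (x : Fin N → EuclideanSpace ℝ (Fin 3)),
      (∀ i j : Fin N, i ≠ j → x i ≠ x j) →
      (∀ (i : Fin N) (y : EuclideanSpace ℝ (Fin 3)), (∀ j : Fin N, j ≠ i → y ≠ x j) → siteEnergy lennardJones x i ≤ ∑ j ∈ Finset.univ.erase i, lennardJones (dist y (x j))) →
      ∀ i : Fin N, ∑ j ∈ Finset.univ.erase i,
        (deriv lennardJones (dist (x i) (x j)) / dist (x i) (x j)) • (x i - x j) = 0)
    (hcoer : ∀ η : ℝ, 0 < η → ∃ c : ℝ, 0 < c ∧ ∃ C : ℝ, ∀ (N : ℕ) (x : Fin N → EuclideanSpace ℝ (Fin 3)),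
      (∀ i j : Fin N, i ≠ j → 1 / 3 ≤ dist (x i) (x j)) →
      (∀ (i : Fin N) (y : EuclideanSpace ℝ (Fin 3)), (∀ j : Fin N, j ≠ i → y ≠ x j) → siteEnergy lennardJones x i ≤ ∑ j ∈ Finset.univ.erase i, lennardJones (dist y (x j))) →
      (∀ i : Fin N, ∑ j ∈ Finset.univ.erase i, (deriv lennardJones (dist (x i) (x j)) / dist (x i) (x j)) • (x i - x j) = 0) →
      ∀ Ω : Finset (Fin N), (∀ i ∈ Ω, IsTwoShellGood (1 / 20) (47 / 50) 1 x i) →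
      (∀ i ∈ Ω, (∀ k : Fin N, dist (x k) (x i) ≤ 8 → k ∈ Ω) →
        (∃ (A : EuclideanSpace ℝ (Fin 3) →ₗᵢ[ℝ] EuclideanSpace ℝ (Fin 3)) (a h : ℝ) (s : ℤ → ℤ), 47 / 50 ≤ a ∧ a ≤ 1 ∧ 39 / 50 * a ≤ h ∧ h ≤ 17 / 20 * a ∧ IsHaggSeq s ∧ (fun S : Set (EuclideanSpace ℝ (Fin 3)) => (∀ j : Fin N, dist (x j) (x i) ≤ 2 → ∃ p ∈ S, dist (x j) p ≤ 2 / 5) ∧ (∀ p ∈ S, dist p (x i) ≤ 2 → ∃ j : Fin N, dist (x j) p ≤ 2 / 5)) {p | ∃ m u v : ℤ, p = x i + A (((u : ℝ) • triangularVec₁ a) + ((v : ℝ) • triangularVec₂ a) + ((haggLabel s m : ℝ) • barlowOffset a) + ((m : ℝ) • layerNormal h))})) →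
        c * (Nat.card {i : Fin N // i ∈ Ω ∧ ((∀ k : Fin N, dist (x k) (x i) ≤ 8 → k ∈ Ω) ∧ ¬ (∃ (A : EuclideanSpace ℝ (Fin 3) →ₗᵢ[ℝ] EuclideanSpace ℝ (Fin 3)) (t : EuclideanSpace ℝ (Fin 3)) (a : ℝ) (s : ℤ → ℤ) (z : ℤ → ℝ), 47 / 50 ≤ a ∧ a ≤ 1 ∧ IsHaggSeq s ∧ (∀ m : ℤ, 39 / 50 * a ≤ z (m + 1) - z m ∧ z (m + 1) - z m ≤ 17 / 20 * a) ∧ (fun S : Set (EuclideanSpace ℝ (Fin 3)) => (∀ j : Fin N, dist (x j) (x i) ≤ 2 → ∃ p ∈ S, dist (x j + t) p ≤ η) ∧ (∀ p ∈ S, dist p (x i + t) ≤ 2 → ∃ j : Fin N, dist (x j + t) p ≤ η)) {p | ∃ m i j : ℤ, p = A (((i : ℝ) • triangularVec₁ a) + ((j : ℝ) • triangularVec₂ a) + ((haggLabel s m : ℝ) • barlowOffset a) + (z m • layerNormal 1))}))} : ℝ) ≤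
          (∑ i ∈ Ω, (1 / 2 : ℝ) * (∑ j ∈ Ω.erase i, lennardJones (dist (x i) (x j)))) - (Ω.card : ℝ) * (⨅ Q : PeriodicConfiguration 3, Q.energyPerParticle lennardJones) + C * (Nat.card {i : Fin N // i ∈ Ω ∧ ∃ j : Fin N, j ∉ Ω ∧ dist (x j) (x i) ≤ 4} : ℝ)) :
  ∀ η : ℝ, 0 < η → ∃ c : ℝ, 0 < c ∧ ∃ C : ℝ, ∀ (N : ℕ) (x : Fin N → EuclideanSpace ℝ (Fin 3)),
      (∀ i j : Fin N, i ≠ j → 1 / 3 ≤ dist (x i) (x j)) →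
      (∀ (i : Fin N) (y : EuclideanSpace ℝ (Fin 3)), (∀ j : Fin N, j ≠ i → y ≠ x j) → siteEnergy lennardJones x i ≤ ∑ j ∈ Finset.univ.erase i, lennardJones (dist y (x j))) →
      ∀ Ω : Finset (Fin N), (∀ i ∈ Ω, IsTwoShellGood (1 / 20) (47 / 50) 1 x i) →
        c * (Nat.card {i : Fin N // i ∈ Ω ∧ ¬ (∃ (A : EuclideanSpace ℝ (Fin 3) →ₗᵢ[ℝ] EuclideanSpace ℝ (Fin 3)) (t : EuclideanSpace ℝ (Fin 3)) (a : ℝ) (s : ℤ → ℤ) (z : ℤ → ℝ), 47 / 50 ≤ a ∧ a ≤ 1 ∧ IsHaggSeq s ∧ (∀ m : ℤ, 39 / 50 * a ≤ z (m + 1) - z m ∧ z (m + 1) - z m ≤ 17 / 20 * a) ∧ (fun S : Set (EuclideanSpace ℝ (Fin 3)) => (∀ j : Fin N, dist (x j) (x i) ≤ 2 → ∃ p ∈ S, dist (x j + t) p ≤ η) ∧ (∀ p ∈ S, dist p (x i + t) ≤ 2 → ∃ j : Fin N, dist (x j + t) p ≤ η)) {p | ∃ m i j : ℤ, p = A (((i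 : ℝ) • triangularVec₁ a) + ((j : ℝ) • triangularVec₂ a) + ((haggLabel s m : ℝ) • barlowOffset a) + (z m • layerNormal 1))})} : ℝ) - C * (Nat.card {i : Fin N // i ∈ Ω ∧ ∃ j : Fin N, j ∉ Ω ∧ dist (x j) (x i) ≤ 4} : ℝ) ≤ (∑ i ∈ Ω, (1 / 2 : ℝ) * (∑ j ∈ Ω.erase i, lennardJones (dist (x i) (x j)))) - (Ω.card : ℝ) * (⨅ Q : PeriodicConfiguration 3, Q.energyPerParticle lennardJones) := by
  intro η hη
  have hδ : (0 : ℝ) < 1 / 3 := by norm_num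
  obtain ⟨c, hc, C, hC⟩ := hcoer η hη
  obtain ⟨Cp, hCp⟩ := stub_pairCountOfCrossing (1 / 3) hδ
  set K : ℝ := 1 + |Cp| * (17 / 4 : ℝ) ^ 4 with hKdef
  refine ⟨c, hc, C + c * K, ?_⟩
  intro N x hsep hNash Ω hΩ
  have key := hC N x hsep hNash (hfb N x (es_distinct_of_sep hsep) hNash) Ω hΩ
    (fun i hi h8 => chart_of_stubs_radius (by norm_num : (3 : ℝ) ≤ 8) stub_chartCoverage hcore stub_chartSites N x Ω hΩ i hi h8)
  have hpair := hCp N x hsep Ω hΩ (17 / 4) (by norm_num)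
  classical
  rw [lc_natCard_eq] at key hpair
  rw [lc_natCard_eq, lc_natCard_eq]
  rw [lc_natCard_eq] at key
  -- the radius-8 collar and the counting `#NL(Ω) ≤ #(NL ∩ int₈Ω) + #B₈`
  set B : Finset (Fin N) := Ω.filter (fun i => ∃ j : Fin N, j ∉ Ω ∧ dist (x j) (x i) ≤ 8) with hBdef
  have hcount : ((Ω.filter fun i : Fin N => ¬ (∃ (A : EuclideanSpace ℝ (Fin 3) →ₗᵢ[ℝ] EuclideanSpace ℝ (Fin 3)) (t : EuclideanSpace ℝ (Fin 3)) (a : ℝ) (s : ℤ → ℤ) (z : ℤ → ℝ), 47 / 50 ≤ a ∧ a ≤ 1 ∧ IsHaggSeq s ∧ (∀ m : ℤ, 39 / 50 * a ≤ z (m + 1) - z m ∧ z (m + 1) - z m ≤ 17 / 20 * a) ∧ (fun S : Set (EuclideanSpace ℝ (Fin 3)) => (∀ j : Fin N, dist (x j) (x i) ≤ 2 → ∃ p ∈ S, dist (x j + t) p ≤ η) ∧ (∀ p ∈ S, dist p (x i + t) ≤ 2 → ∃ j : Fin N, dist (x j + t) p ≤ η)) {p | ∃ m i j : ℤ, p =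 A (((i : ℝ) • triangularVec₁ a) + ((j : ℝ) • triangularVec₂ a) + ((haggLabel s m : ℝ) • barlowOffset a) + (z m • layerNormal 1))})).card : ℝ) ≤
      ((Ω.filter fun i : Fin N => ((∀ k : Fin N, dist (x k) (x i) ≤ 8 → k ∈ Ω) ∧ ¬ (∃ (A : EuclideanSpace ℝ (Fin 3) →ₗᵢ[ℝ] EuclideanSpace ℝ (Fin 3)) (t : EuclideanSpace ℝ (Fin 3)) (a : ℝ) (s : ℤ → ℤ) (z : ℤ → ℝ), 47 / 50 ≤ a ∧ a ≤ 1 ∧ IsHaggSeq s ∧ (∀ m : ℤ, 39 / 50 * a ≤ z (m + 1) - z m ∧ z (m + 1) - z m ≤ 17 / 20 * a) ∧ (fun S : Set (EuclideanSpace ℝ (Fin 3)) => (∀ j : Fin N, dist (x j) (x i) ≤ 2 → ∃ p ∈ S, dist (x j + t) p ≤ η) ∧ (∀ p ∈ S, dist p (x i + t) ≤ 2 → ∃ j : Fin N, dist (x j + t) p ≤ η)) {p | ∃ m i j : ℤ, p = A (((i : ℝ) • triangularVec₁ a) + ((j : ℝ) • triangularVec₂ a) + ((haggLabel s m : ℝ)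 • barlowOffset a) + (z m • layerNormal 1))}))).card : ℝ) + (B.card : ℝ) := by
    have hsub : (Ω.filter fun i : Fin N => ¬ (∃ (A : EuclideanSpace ℝ (Fin 3) →ₗᵢ[ℝ] EuclideanSpace ℝ (Fin 3)) (t : EuclideanSpace ℝ (Fin 3)) (a : ℝ) (s : ℤ → ℤ) (z : ℤ → ℝ), 47 / 50 ≤ a ∧ a ≤ 1 ∧ IsHaggSeq s ∧ (∀ m : ℤ, 39 / 50 * a ≤ z (m + 1) - z m ∧ z (m + 1) - z m ≤ 17 / 20 * a) ∧ (fun S : Set (EuclideanSpace ℝ (Fin 3)) => (∀ j : Fin N, dist (x j) (x i) ≤ 2 → ∃ p ∈ S, dist (x j + t) p ≤ η) ∧ (∀ p ∈ S, dist p (x i + t) ≤ 2 → ∃ j : Fin N, dist (x j + t) p ≤ η)) {p | ∃ m i j : ℤ, p = A (((i : ℝ) • triangularVec₁ a) + ((j : ℝ) • triangularVec₂ a) + ((haggLabel s m : ℝ) • barlowOffset a) + (z m • layerNormal 1))})) ⊆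
        (Ω.filter fun i : Fin N => ((∀ k : Fin N, dist (x k) (x i) ≤ 8 → k ∈ Ω) ∧ ¬ (∃ (A : EuclideanSpace ℝ (Fin 3) →ₗᵢ[ℝ] EuclideanSpace ℝ (Fin 3)) (t : EuclideanSpace ℝ (Fin 3)) (a : ℝ) (s : ℤ → ℤ) (z : ℤ → ℝ), 47 / 50 ≤ a ∧ a ≤ 1 ∧ IsHaggSeq s ∧ (∀ m : ℤ, 39 / 50 * a ≤ z (m + 1) - z m ∧ z (m + 1) - z m ≤ 17 / 20 * a) ∧ (fun S : Set (EuclideanSpace ℝ (Fin 3)) => (∀ j : Fin N, dist (x j) (x i) ≤ 2 → ∃ p ∈ S, dist (x j + t) p ≤ η) ∧ (∀ p ∈ S, dist p (x i + t) ≤ 2 → ∃ j : Fin N, dist (x j + t) p ≤ η)) {p | ∃ m i j : ℤ, p = A (((i : ℝ) • triangularVec₁ a) + ((j : ℝ) • triangularVec₂ a) + ((haggLabel s m : ℝ) • barlowOffset a) + (z m • layerNormal 1))}))) ∪ B := by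
      intro i hi
      rw [Finset.mem_filter] at hi
      rw [Finset.mem_union, Finset.mem_filter, hBdef, Finset.mem_filter]
      by_cases h8 : ∀ k : Fin N, dist (x k) (x i) ≤ 8 → k ∈ Ω
      · exact Or.inl ⟨hi.1, h8, hi.2⟩
      · push Not at h8
        obtain ⟨k, hk, hkΩ⟩ := h8
        exact Or.inr ⟨hi.1, k, hkΩ, hk⟩
    exact_mod_cast (Finset.card_le_card hsub).trans (Finset.card_union_le _ _)
  -- the collar count: `#B₈ ≤ K · #∂₄Ω`
  have hcol := collar8_card_le x Ω
  set B4c : ℝ := ((Ω.filter fun i => ∃ j : Fin N, j ∉ Ω ∧ dist (x j) (x i) ≤ 4).card : ℝ) with hB4c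
  have hB40 : 0 ≤ B4c := Nat.cast_nonneg _
  have hBle : (B.card : ℝ) ≤ K * B4c := by
    have h1 : (B.card : ℝ) ≤ B4c + Cp * (17 / 4 : ℝ) ^ 4 * B4c := by
      have := hcol
      rw [← hBdef] at this
      linarith
    have h2 : Cp * (17 / 4 : ℝ) ^ 4 * B4c ≤ |Cp| * (17 / 4 : ℝ) ^ 4 * B4c :=
      mul_le_mul_of_nonneg_right (mul_le_mul_of_nonneg_right (le_abs_self Cp) (by positivity)) hB40
    rw [hKdef]
    nlinarith
  have hcK : 0 ≤ c := hc.le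
  have hstep : c * (B.card : ℝ) ≤ c * (K * B4c) := mul_le_mul_of_nonneg_left hBle hcK
  nlinarith [key, hcount, hstep, hB40]


/-- **NashPNF ⟹ the crux, inline (proved; the twin's `stub_cruxOfPureNearField` re-run on the Nash class at
`δ = 1/3`).**  The cross terms with `Ωᶜ` are boundary-summable (`pnf_cross_floor` with the interface lemma);
`C` grows by `(250/12)·3⁶ + |K(1/3)|/12`. -/
theorem es_nashNearField_of_pnf
    (hPNF : (∀ η : ℝ, 0 < η → ∃ c : ℝ, 0 < c ∧ ∃ C : ℝ, ∀ (N : ℕ) (x : Fin N → EuclideanSpace ℝ (Fin 3)),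
      (∀ i j : Fin N, i ≠ j → 1 / 3 ≤ dist (x i) (x j)) →
      (∀ (i : Fin N) (y : EuclideanSpace ℝ (Fin 3)), (∀ j : Fin N, j ≠ i → y ≠ x j) → siteEnergy lennardJones x i ≤ ∑ j ∈ Finset.univ.erase i, lennardJones (dist y (x j))) →
      ∀ Ω : Finset (Fin N), (∀ i ∈ Ω, IsTwoShellGood (1 / 20) (47 / 50) 1 x i) →
        c * (Nat.card {i : Fin N // i ∈ Ω ∧ ¬ (∃ (A : EuclideanSpace ℝ (Fin 3) →ₗᵢ[ℝ] EuclideanSpace ℝ (Fin 3)) (t : EuclideanSpace ℝ (Fin 3)) (a : ℝ) (s : ℤ → ℤ) (z : ℤ → ℝ), 47 / 50 ≤ a ∧ a ≤ 1 ∧ IsHaggSeq s ∧ (∀ m : ℤ, 39 / 50 * a ≤ z (m + 1) - z m ∧ z (m + 1) - z m ≤ 17 / 20 * a) ∧ (fun S : Set (EuclideanSpace ℝ (Fin 3)) => (∀ j : Fin N, dist (x j) (x i) ≤ 2 → ∃ p ∈ S, dist (x j + t) p ≤ η) ∧ (∀ p ∈ S, dist p (x i + t) ≤ 2 → ∃ j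 : Fin N, dist (x j + t) p ≤ η)) {p | ∃ m i j : ℤ, p = A (((i : ℝ) • triangularVec₁ a) + ((j : ℝ) • triangularVec₂ a) + ((haggLabel s m : ℝ) • barlowOffset a) + (z m • layerNormal 1))})} : ℝ) - C * (Nat.card {i : Fin N // i ∈ Ω ∧ ∃ j : Fin N, j ∉ Ω ∧ dist (x j) (x i) ≤ 4} : ℝ) ≤ (∑ i ∈ Ω, (1 / 2 : ℝ) * (∑ j ∈ Ω.erase i, lennardJones (dist (x i) (x j)))) - (Ω.card : ℝ) * (⨅ Q : PeriodicConfiguration 3, Q.energyPerParticle lennardJones))) :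
    Summit.AtomisticToContinuum.Crystallization.Theses.NashClassCertificates.NashNearField := by
  intro η hη
  have hδ : (0 : ℝ) < 1 / 3 := by norm_num
  obtain ⟨K, hK⟩ := stub_interfaceOfPairCount stub_pairCountOfCrossing (1 / 3) hδ
  obtain ⟨c, hc, C, hC⟩ := hPNF η hη
  refine ⟨c, hc, C + 250 / 12 * (1 / 3 : ℝ)⁻¹ ^ 6 + |K| / 12, fun N x hsep hNash Ω hΩ => ?_⟩
  have hcross := pnf_cross_floor x hδ hsep Ω (hK N x hsep Ω hΩ)
  have hmain := hC N x hsep hNash Ω hΩ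
  rw [pnf_siteSum_split x Ω]
  have hG0 : (0 : ℝ) ≤ (Nat.card {i : Fin N // i ∈ Ω ∧ ∃ j : Fin N, j ∉ Ω ∧ dist (x j) (x i) ≤ 4} : ℝ) :=
    Nat.cast_nonneg _
  nlinarith [hcross, hmain, hG0]


/-- **THE CRUX MODULO ITS TWO ENERGY STUBS (line `birth`, skeleton v10): `stub_nashFlatnessPaid` (I_flat on the Nash class) and
`stub_nashRoughSitesPaid` (II_band on the Nash class) imply `NashClassCertificates.NashNearField` BY NAME.**  Everything else is landed:
the chart core (`stub_labelledPlacement` + `stub_chartCore_of_labelled_placement`, coverage, sites, `chart_of_stubs_radius`), exact force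
balance on the Nash class (`stub_nashForceBalance`), C′ (`stub_offFamilyOfNonLayered`), the interface chain, and the compositions of this
file and of `…EnergySplitInterior`.  When the two stubs land (or the twin crux 13958's `stub_flatnessPaid` / `stub_roughSitesPaid`, which imply
them), the crux closes by `nashNearField_of_energySplit I II`. -/
theorem nashNearField_of_energySplit
    (hI : (∃ ε₁ : ℝ, 1 / 100 ≤ ε₁ ∧ ε₁ ≤ 1 / 20 ∧ ∃ K : ℝ, 0 ≤ K ∧ ∃ C : ℝ, ∀ (N : ℕ) (x : Fin N → EuclideanSpace ℝ (Fin 3)),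
      (∀ i j : Fin N, i ≠ j → 1 / 3 ≤ dist (x i) (x j)) →
      (∀ (i : Fin N) (y : EuclideanSpace ℝ (Fin 3)), (∀ j : Fin N, j ≠ i → y ≠ x j) → siteEnergy lennardJones x i ≤ ∑ j ∈ Finset.univ.erase i, lennardJones (dist y (x j))) →
      (∀ i : Fin N, ∑ j ∈ Finset.univ.erase i, (deriv lennardJones (dist (x i) (x j)) / dist (x i) (x j)) • (x i - x j) = 0) →
      ∀ Ω : Finset (Fin N), (∀ i ∈ Ω, IsTwoShellGood ε₁ (47 / 50) 1 x i) →
      ∃ (sW : Fin N → ℤ → ℤ) (Gw : Fin N → (EuclideanSpace ℝ (Fin 3) →L[ℝ] EuclideanSpace ℝ (Fin 3))) (νw rw : Fin N → ℝ) (Aw : Fin N → (EuclideanSpace ℝ (Fin 3) →ₗᵢ[ℝ] EuclideanSpace ℝ (Fin 3))) (aw hw : Fin N → ℝ), (∀ i ∈ Ω, (∀ k : Fin N, dist (x k) (x i) ≤ 8 → k ∈ Ω) → IsHaggSeq (sW i) ∧ 0 ≤ νw i ∧ ((∀ j : Fin N, dist (x j) (x i) ≤ 3 → ∃ m u v : ℤ,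 dist (x j - x i) ((Gw i) (barlowPos 1 (Real.sqrt 6 / 3) (sW i) m u v)) ≤ (νw i)) ∧ (∀ m u v : ℤ, ‖(Gw i) (barlowPos 1 (Real.sqrt 6 / 3) (sW i) m u v)‖ ≤ 3 → ∃ j : Fin N, dist (x j - x i) ((Gw i) (barlowPos 1 (Real.sqrt 6 / 3) (sW i) m u v)) ≤ (νw i)) ∧ (∀ p : EuclideanSpace ℝ (Fin 3), 4 / 5 * ‖p‖ ≤ ‖(Gw i) p‖ ∧ ‖(Gw i) p‖ ≤ 6 / 5 * ‖p‖)) ∧ 47 / 50 ≤ aw i ∧ aw i ≤ 1 ∧ 39 / 50 * aw i ≤ hw i ∧ hw i ≤ 17 / 20 * aw i ∧ (∀ m u v : ℤ, ‖barlowPos 1 (Real.sqrt 6 / 3) (sW i) m u v‖ ≤ 3 → dist ((Gw i) (barlowPos 1 (Real.sqrt 6 / 3) (sW i) m u v)) ((Aw i) (barlowPos (aw i) (hw i) (sW i) m u v)) < rw i)) ∧ (∑ i ∈ Ω.filter (fun i => ∀ k : Fin N, dist (x k) (x i) ≤ 8 → k ∈ Ω), (2400 * (νw i) ^ 2 + 800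 * (rw i) ^ 2)) ≤ K * ((∑ i ∈ Ω, (1 / 2 : ℝ) * (∑ j ∈ Ω.erase i, lennardJones (dist (x i) (x j)))) - (Ω.card : ℝ) * (⨅ Q : PeriodicConfiguration 3, Q.energyPerParticle lennardJones)) + C * (Nat.card {i : Fin N // i ∈ Ω ∧ ∃ j : Fin N, j ∉ Ω ∧ dist (x j) (x i) ≤ 4} : ℝ)))
    (hII : (∀ ε₁ : ℝ, 1 / 100 ≤ ε₁ → ε₁ ≤ 1 / 20 → ∃ K : ℝ, 0 ≤ K ∧ ∃ C : ℝ, ∀ (N : ℕ) (x : Fin N → EuclideanSpace ℝ (Fin 3)),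
      (∀ i j : Fin N, i ≠ j → 1 / 3 ≤ dist (x i) (x j)) →
      (∀ (i : Fin N) (y : EuclideanSpace ℝ (Fin 3)), (∀ j : Fin N, j ≠ i → y ≠ x j) → siteEnergy lennardJones x i ≤ ∑ j ∈ Finset.univ.erase i, lennardJones (dist y (x j))) →
      (∀ i : Fin N, ∑ j ∈ Finset.univ.erase i, (deriv lennardJones (dist (x i) (x j)) / dist (x i) (x j)) • (x i - x j) = 0) →
      ∀ Ω : Finset (Fin N), (∀ i ∈ Ω, IsTwoShellGood (1 / 20) (47 / 50) 1 x i) →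
      (∀ i ∈ Ω, (∀ k : Fin N, dist (x k) (x i) ≤ 3 → k ∈ Ω) → (∃ (A : EuclideanSpace ℝ (Fin 3) →ₗᵢ[ℝ] EuclideanSpace ℝ (Fin 3)) (a h : ℝ) (s : ℤ → ℤ), 47 / 50 ≤ a ∧ a ≤ 1 ∧ 39 / 50 * a ≤ h ∧ h ≤ 17 / 20 * a ∧ IsHaggSeq s ∧ (fun S : Set (EuclideanSpace ℝ (Fin 3)) => (∀ j : Fin N, dist (x j) (x i) ≤ 2 → ∃ p ∈ S, dist (x j) p ≤ 2 / 5) ∧ (∀ p ∈ S, dist p (x i) ≤ 2 → ∃ j : Fin N, dist (x j) p ≤ 2 / 5)) {p | ∃ m u v : ℤ, p = x i + A (((u : ℝ) • triangularVec₁ a) + ((v : ℝ) • triangularVec₂ a) + ((haggLabel s m : ℝ) • barlowOffset a) + ((m : ℝ) • layerNormal h))})) → (Nat.card {i : Fin N // i ∈ Ω ∧ ¬ IsTwoShellGood ε₁ (47 / 50) 1 x i} : ℝ) ≤ K * ((∑ i ∈ Ω, (1 / 2 : ℝ) * (∑ j ∈ Ω.erase i, lennardJones (dist (x i) (x j))))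 - (Ω.card : ℝ) * (⨅ Q : PeriodicConfiguration 3, Q.energyPerParticle lennardJones)) + C * (Nat.card {i : Fin N // i ∈ Ω ∧ ∃ j : Fin N, j ∉ Ω ∧ dist (x j) (x i) ≤ 4} : ℝ))) :
    Summit.AtomisticToContinuum.Crystallization.Theses.NashClassCertificates.NashNearField :=
  es_nashNearField_of_pnf (es_pnf_of_interiorCoercivity (stub_chartCore_of_labelled_placement stub_labelledPlacement) stub_nashForceBalance
    (es_interiorCoercivity_of_split stub_offFamilyOfNonLayered hI hII
      (chart_of_stubs_radius le_rfl stub_chartCoverage (stub_chartCore_of_labelled_placement stub_labelledPlacement) stub_chartSites)))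

end Summit.AtomisticToContinuum.Crystallization.Theorems.NashClassCertificatesNashNearField

end
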